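import Literature.Barriers.CriticalPhenomena.RandomClusterFirstOrderProofs
import Literature.Probability.LatticeModels.RCBoxEnsembles
import HarnessLib

/-!
# First-order transition of the random-cluster model for large `q`: the proof

Topic `Literature/Barriers/CriticalPhenomena`. The discharge of the barrier fact
`RandomClusterFirstOrder` (Grimmett 2006, Thm. (7.33)(b), wired half; Laanait–Messager–Miracle-Solé–
Ruiz–Shlosman 1991): for every `d ≥ 2` there is `Q` such that for all real `q > Q` the wired
percolation probability is positive at `p_c(q)`.

The proof is the Pirogov–Sinai contour argument, assembled from the `Literature/Probability/
LatticeModels/RC*` and `PS*` files: the random-cluster model on `ℤ^d` at `t² = p/(1-p)` is a two-phase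
contour model (`rcModel`, with the exact external-contour representation `rcModel_rec`, translation
covariance `rcShift`/`K_shift`, the contour count `4^{3^d}` per support site and the Peierls estimate
`ρ(γ) ≤ e^{-τ|γ̄|}`, `τ = rcPeierlsRate d q`, on the window `|2d log t - log q| ≤ 1`); the
abstract pointwise Pirogov–Sinai theorem (`RCC.K_le_exp`, from `ContourModel.K_le_exp_of_excess_eq_zero`)
makes, for `q` large, all contours of a *stable* phase `τ̂`-suppressed, and some phase is always stable
(`exists_excess_eq_zero'`), the `ord` phase at the upper end of the window and the `dis` phase at the
lower end (`excess_eq_zero_of_log_le'`). Through the exact identification of the wired/free box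
measures with the `ord`/`dis` volume ensembles (`real_rcMeasure_wired_origin`,
`real_rcMeasure_free_eq_ensProb`) and the Peierls bounds (`ensProb_exists_le`, `sum_K_hull_le`,
`sum_K_hull_ge_le`) of `RCBoxEnsembles`, stability of `ord` gives uniform wired percolation `θ¹_{Λ_n} ≥ 1/2` and stability
of `dis` gives uniform decay of the free connection probabilities; the dichotomy on the window
`[p_bot, p_top]` then feeds `RandomClusterFirstOrder_of_dichotomy`.

Everything is proved; no named facts.

## References

* G. Grimmett, *The Random-Cluster Model*, Springer 2006, Thm. (7.33)(b) and its proof in §7.5,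
  eqs. (7.79)–(7.83). [Grimmett2006]
* L. Laanait, A. Messager, S. Miracle-Solé, J. Ruiz, S. Shlosman, *Interfaces in the Potts model I:
  Pirogov–Sinai theory of the Fortuin–Kasteleyn representation*, Comm. Math. Phys. 140 (1991) 81–91.
  [LaanaitEtAl1991]
* S. Friedli, Y. Velenik, *Statistical Mechanics of Lattice Systems*, CUP 2017, Ch. 7 (Pirogov–Sinai
  theory). [FriedliVelenik2017]
-/

noncomputable section

namespace Literature.Barriers.CriticalPhenomena

open MeasureTheory Finset Literature.Probability.LatticeModels Literature.Probability.LatticeModels.RCC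
  Literature.Probability.LatticeModels.ContourSetup Literature.Probability.Percolation

open scoped Classical

namespace RandomClusterFirstOrderPS

variable {d : ℕ}

/-! ### Parameters -/

/-- The effective rate `τ̂ = τ(q) - 4^{d+2}`, `τ(q) = rcPeierlsRate d q`. [cite: FriedliVelenik2017, §7.4.3] -/
def tauHat (d : ℕ) (q : ℝ) : ℝ := rcPeierlsRate d q - 4 ^ (d + 2)

/-- The Peierls ratio `B = 2·9^d·4^{3^d}·e^{-τ̂}`. [cite: Grimmett2006, §7.5] -/
def Bof (d : ℕ) (q : ℝ) : ℝ := 2 * 9 ^ d * 4 ^ 3 ^ d * Real.exp (-tauHat d q)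

/-- The threshold `Q(d)`. [cite: Grimmett2006, Thm. (7.33) (Q(d))] -/
def Qof (d : ℕ) : ℝ :=
  Real.exp ((2 * d * (d + 1) * 9 ^ d) *
    (max (Real.log ((4 ^ 3 ^ d : ℕ) * (2 ^ (d + 1) * 9 ^ d) * Real.exp ((2 * d + 2) * 2 ^ d)))
      (Real.log (8 * 9 ^ d * 4 ^ 3 ^ d)) + 2 + 4 ^ (d + 2) + 1))

/-- **Above the threshold the two numeric conditions hold**: the smallness condition of the
abstract Pirogov–Sinai theorem and `B ≤ 1/4`. [cite: Grimmett2006, Thm. (7.33) (q large)] -/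
theorem conditions_of_gt (hd : 1 ≤ d) {q : ℝ} (hq : 1 ≤ q) (hQ : Qof d < q) :
    StableRegime d q ∧ Bof d q ≤ 1 / 4 := by
  have hα : (0 : ℝ) < 2 * d * (d + 1) * 9 ^ d := by positivity
  set L := max (Real.log ((4 ^ 3 ^ d : ℕ) * (2 ^ (d + 1) * 9 ^ d) * Real.exp ((2 * d + 2) * 2 ^ d)))
    (Real.log (8 * 9 ^ d * 4 ^ 3 ^ d)) with hL
  have hq0 : 0 < q := by linarith
  have hlog : (2 * d * (d + 1) * 9 ^ d) * (L + 2 + 4 ^ (d + 2) + 1) < Real.log q := by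
    have hQ' : Real.exp ((2 * d * (d + 1) * 9 ^ d) * (L + 2 + 4 ^ (d + 2) + 1)) < q := hQ
    exact (Real.lt_log_iff_exp_lt hq0).2 hQ'
  have hτ : L < rcPeierlsRate d q - 4 ^ (d + 2) := by
    rw [rcPeierlsRate, lt_sub_iff_add_lt, lt_sub_iff_add_lt, lt_div_iff₀ hα]
    nlinarith
  set A₁ : ℝ := (4 ^ 3 ^ d : ℕ) * (2 ^ (d + 1) * 9 ^ d) * Real.exp ((2 * d + 2) * 2 ^ d) with hA₁
  set A₂ : ℝ := 8 * 9 ^ d * 4 ^ 3 ^ d with hA₂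
  have hA₁pos : 0 < A₁ := by positivity
  have hA₂pos : 0 < A₂ := by positivity
  have h1 : A₁ * Real.exp (-(rcPeierlsRate d q - 4 ^ (d + 2))) < 1 := by
    have : Real.log A₁ < rcPeierlsRate d q - 4 ^ (d + 2) := (le_max_left _ _).trans_lt hτ
    have := Real.exp_lt_exp.2 this
    rw [Real.exp_log hA₁pos] at this
    calc A₁ * Real.exp (-(rcPeierlsRate d q - 4 ^ (d + 2))) < Real.exp (rcPeierlsRate d q - 4 ^ (d + 2)) * Real.exp (-(rcPeierlsRate d q - 4 ^ (d + 2))) :=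
          mul_lt_mul_of_pos_right this (Real.exp_pos _)
      _ = 1 := by rw [← Real.exp_add, add_neg_cancel, Real.exp_zero]
  have h2 : A₂ * Real.exp (-(rcPeierlsRate d q - 4 ^ (d + 2))) < 1 := by
    have : Real.log A₂ < rcPeierlsRate d q - 4 ^ (d + 2) := (le_max_right _ _).trans_lt hτ
    have := Real.exp_lt_exp.2 this
    rw [Real.exp_log hA₂pos] at this
    calc A₂ * Real.exp (-(rcPeierlsRate d q - 4 ^ (d + 2))) < Real.exp (rcPeierlsRate d q - 4 ^ (d + 2)) * Real.exp (-(rcPeierlsRate d q - 4 ^ (d + 2))) :=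
          mul_lt_mul_of_pos_right this (Real.exp_pos _)
      _ = 1 := by rw [← Real.exp_add, add_neg_cancel, Real.exp_zero]
  constructor
  · rw [StableRegime, show (2 * (d : ℝ) + 2) * 2 ^ d - (rcPeierlsRate d q - 4 ^ (d + 2)) =
      (2 * d + 2) * 2 ^ d + -(rcPeierlsRate d q - 4 ^ (d + 2)) from by ring, Real.exp_add, ← mul_assoc]
    exact h1.le
  · rw [Bof, tauHat]
    have : (2 : ℝ) * 9 ^ d * 4 ^ 3 ^ d * Real.exp (-(rcPeierlsRate d q - 4 ^ (d + 2))) = A₂ * Real.exp (-(rcPeierlsRate d q - 4 ^ (d + 2))) / 4 := by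
      rw [hA₂]; ring
    rw [this]; linarith

/-! ### The contour model on the window and the stable phases -/

section Window

variable (hd : 2 ≤ d) {q : ℝ} (hq : 1 ≤ q) {t : ℝ} (ht : 0 < t) (hs : |2 * d * Real.log t - Real.log q| ≤ 1)
  (hreg : StableRegime d q)

/-- Positivity of `q`. [folklore] -/
theorem q_pos_of_one_le (hq : 1 ≤ q) : 0 < q := one_pos.trans_le hq

include hd hq ht hs hreg in
/-- **All contours of a stable phase are `τ̂`-suppressed** (the abstract Pirogov–Sinai theorem applied
to the random-cluster contour model). [cite: FriedliVelenik2017, §7.4.3, Prop. 7.34; Grimmett2006, §7.5] -/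
theorem K_le_of_stable {σ : Phase} (hσ : (rcModel d ht (q_pos_of_one_le hq)).excess (rcPeierlsRate d q - 4 ^ (d + 2)) σ = 0) (γ : (rcSetup d).Γ)
    (hγ : (rcSetup d).type γ = σ) : (rcModel d ht (q_pos_of_one_le hq)).K γ ≤ Real.exp (-tauHat d q * (rcSetup d).size γ) :=
  K_le_exp hd ht (q_pos_of_one_le hq) hq hs hreg hσ hγ

/-- Some phase is stable. [cite: FriedliVelenik2017, §7.4.1 (min a = 0)] -/
theorem exists_stable : ∃ σ, (rcModel d ht (q_pos_of_one_le hq)).excess (rcPeierlsRate d q - 4 ^ (d + 2)) σ = 0 :=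
  exists_excess_eq_zero' ht (q_pos_of_one_le hq) _

/-! ### Wired percolation from stability of `ord` -/

include hd hq in
/-- `θ¹_{Λ_0} = 1`. [folklore] -/
theorem thetaWiredBox_zero' {p : ℝ} (hp : p ∈ Set.Icc (0 : ℝ) 1) : thetaWiredBox d p q 0 = 1 := by
  haveI := isProbabilityMeasure_rcMeasure (boxGraph d 0) hp (q_pos_of_one_le hq) (boxBoundary d 0)
  rw [thetaWiredBox, show {ω : BondConfig (BoxV d 0) | ∃ y : BoxV d 0, y ∈ boxBoundary d 0 ∧ (openGraph ω).Reachable (boxOrigin d 0) y} = Set.univ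
    from Set.eq_univ_of_forall fun ω => ⟨boxOrigin d 0, ?_, SimpleGraph.Reachable.refl _⟩]
  · exact probReal_univ
  · change (0 : Site d) ∈ innerBoundary (zdGraph d) (box d 0)
    exact mem_innerBoundary_box.2 ⟨RCC.zero_mem_box 0, ⟨0, by omega⟩, rfl⟩

include hd hq ht hs hreg in
/-- **Stability of `ord` gives uniform wired percolation `θ¹_{Λ_n}(p,q) ≥ 1/2`** (`p = t²/(1+t²)`,
`B ≤ 1/4`). [cite: Grimmett2006, §7.5, proof of Thm. (7.33), eq. (7.79)] -/
theorem half_le_thetaWiredBox (hσ : (rcModel d ht (q_pos_of_one_le hq)).excess (rcPeierlsRate d q - 4 ^ (d + 2)) Phase.ord = 0)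
    (hB : Bof d q ≤ 1 / 4) (n : ℕ) : 1 / 2 ≤ thetaWiredBox d (pOf t) q n := by
  have hp : pOf t ∈ Set.Icc (0 : ℝ) 1 := ⟨(pOf_mem t ht).1.le, (pOf_mem t ht).2.le⟩
  have hd1 : 1 ≤ d := by omega
  cases n with
  | zero => rw [thetaWiredBox_zero' hd hq hp]; norm_num
  | succ N =>
    -- the box measure is the ensemble probability of the connection event
    have hid : thetaWiredBox d (pOf t) q (N + 1) = ensProb t q Phase.ord (box d (N + 3)) (Aev N) := by
      have h := real_rcMeasure_wired_origin (d := d) N hd1 ht (q_pos_of_one_le hq)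
      rw [thetaWiredBox_eq]
      convert h using 2 <;> rfl
    have hK : ∀ γ : (rcSetup d).Γ, (rcSetup d).type γ = Phase.ord →
        (rcModel d ht (q_pos_of_one_le hq)).K γ ≤ Real.exp (-tauHat d q * (rcSetup d).size γ) := fun γ hγ => K_le_of_stable hd hq ht hs hreg hσ γ hγ
    have hB1 : (2 : ℝ) * 9 ^ d * 4 ^ 3 ^ d * Real.exp (-tauHat d q) < 1 := by change Bof d q < 1; linarith
    have h1 := ensProb_exists_le hd ht (q_pos_of_one_le hq) (starConn_compl_box hd (N + 3)) (σ := Phase.ord)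
      (fun γ => (0 : Site d) ∈ (rcSetup d).hull γ)
    have h2 := sum_K_hull_le hd ht (q_pos_of_one_le hq) (σ := Phase.ord) (box d (N + 3)) hK hB1
    rw [hid, ← sub_le_sub_iff_left (1 : ℝ), ← ensProb_not ht (q_pos_of_one_le hq)]
    refine le_trans ?_ (h1.trans (h2.trans ?_))
    · exact ensProb_not_aev_le N hd ht (q_pos_of_one_le hq)
    · change Bof d q / (1 - Bof d q) ≤ 1 - 1 / 2
      rw [div_le_iff₀ (by linarith)]
      nlinarith

/-! ### Free decay from stability of `dis` -/

include hd hq ht hs hreg in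
/-- **Stability of `dis` gives uniform decay of the free connection probabilities**
(`p = t²/(1+t²)`, `B ≤ 1/4`). [cite: Grimmett2006, §7.5, proof of Thm. (7.33), eqs. (7.81)–(7.82)] -/
theorem mem_freeDecaySet_of_dis (hσ : (rcModel d ht (q_pos_of_one_le hq)).excess (rcPeierlsRate d q - 4 ^ (d + 2)) Phase.dis = 0)
    (hB : Bof d q ≤ 1 / 4) : pOf t ∈ freeDecaySet d q := by
  rw [mem_freeDecaySet_iff]
  intro ε hε
  have hB0 : 0 ≤ Bof d q := by rw [Bof]; positivity
  have hB1 : Bof d q < 1 := by linarith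
  -- choose `m ≥ 1` with `B^{m+1}/(1-B) ≤ ε`
  obtain ⟨m₀, hm₀⟩ := exists_pow_lt_of_lt_one (mul_pos hε (by linarith : (0 : ℝ) < 1 - Bof d q)) hB1
  set m := m₀ + 1 with hm
  refine ⟨m, fun k => ?_⟩
  have hK : ∀ γ : (rcSetup d).Γ, (rcSetup d).type γ = Phase.dis →
      (rcModel d ht (q_pos_of_one_le hq)).K γ ≤ Real.exp (-tauHat d q * (rcSetup d).size γ) := fun γ hγ => K_le_of_stable hd hq ht hs hreg hσ γ hγ
  -- the free box measure is the ensemble probability of `Pm m`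
  have hid : boxFreeReal d (pOf t) q m (originToBoundary d m) k = ensProb t q Phase.dis (box d (m + k + 3)) (Pm m) := by
    have h := real_rcMeasure_free_eq_ensProb (d := d) (m + k) ht (q_pos_of_one_le hq) (Pm m)
      (fun ω => pm_iff_pm_inter (box_mono d (Nat.le_add_right m k)) ω)
      (finsetRestrict (box_mono d (Nat.le_add_right m k)) ⁻¹' originToBoundary d m) fun ωb hωb => by
        rw [Set.mem_preimage]
        exact mem_preimage_origin_iff (box_mono d (Nat.le_add_right m k)) hωb
    rw [boxFreeReal]
    convert h using 2
  have hB1' : (2 : ℝ) * 9 ^ d * 4 ^ 3 ^ d * Real.exp (-tauHat d q) < 1 := hB1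
  have h1 := ensProb_exists_le hd ht (q_pos_of_one_le hq) (starConn_compl_box hd (m + k + 3)) (σ := Phase.dis)
    (fun γ => (0 : Site d) ∈ (rcSetup d).hull γ ∧ m + 1 ≤ (rcSetup d).size γ)
  have h2 := sum_K_hull_ge_le hd ht (q_pos_of_one_le hq) (σ := Phase.dis) (box d (m + k + 3)) hK hB1' m
  rw [hid]
  refine le_trans ?_ (h1.trans (h2.trans ?_))
  · refine ensProb_mono ht (q_pos_of_one_le hq) fun ω hω hP => ?_
    obtain ⟨γ, hγ, h0, hsz⟩ := exists_big_hull_of_pm (m + k) hd (by omega) hω hP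
    exact ⟨γ, by rw [xc_eq hω]; exact hγ, h0, hsz⟩
  · change Bof d q ^ (m + 1) / (1 - Bof d q) ≤ ε
    rw [div_le_iff₀ (by linarith)]
    calc Bof d q ^ (m + 1) ≤ Bof d q ^ m₀ := pow_le_pow_of_le_one hB0 hB1.le (by omega)
      _ ≤ ε * (1 - Bof d q) := hm₀.le

/-! ### The dichotomy on the window -/

include hd hq ht hs hreg in
/-- **On the window every `p(t)` percolates (wired) or decays (free).** [cite: Grimmett2006, §7.5, Thm. (7.42), eq. (7.62)] -/
theorem window_dichotomy (hB : Bof d q ≤ 1 / 4) : pOf t ∈ wiredPercolationSet d q (1 / 2) ∨ pOf t ∈ freeDecaySet d q := by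
  obtain ⟨σ, hσ⟩ := exists_stable hq ht
  cases σ with
  | ord => exact Or.inl fun n => half_le_thetaWiredBox hd hq ht hs hreg hσ hB n
  | dis => exact Or.inr (mem_freeDecaySet_of_dis hd hq ht hs hreg hσ hB)

end Window

/-! ### The endpoints of the window -/

/-- `2 e^{-(2d+1)} ≤ 1`. [folklore] -/
theorem two_mul_exp_neg_le_one (d : ℕ) : 2 * Real.exp (-(2 * (d : ℝ) + 1)) ≤ 1 := by
  have h1 : Real.exp (-(2 * (d : ℝ) + 1)) ≤ Real.exp (-1) := Real.exp_le_exp.2 (by have : (0 : ℝ) ≤ d := Nat.cast_nonneg d; linarith)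
  have h2 : (1 : ℝ) + 1 ≤ Real.exp 1 := Real.add_one_le_exp 1
  have h3 : Real.exp (-1) * Real.exp 1 = 1 := by rw [← Real.exp_add, neg_add_cancel, Real.exp_zero]
  nlinarith [Real.exp_pos (-1 : ℝ), Real.exp_pos (1 : ℝ)]

/-- The upper end of the window `t_top = e^{(log q + 1)/(2d)}`. [cite: Grimmett2006, §7.5] -/
def tTop (d : ℕ) (q : ℝ) : ℝ := Real.exp ((Real.log q + 1) / (2 * d))

/-- The lower end of the window `t_bot = e^{(log q - 1)/(2d)}`. [cite: Grimmett2006, §7.5] -/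
def tBot (d : ℕ) (q : ℝ) : ℝ := Real.exp ((Real.log q - 1) / (2 * d))

/-- `2d log t_top - log q = 1`. [folklore] -/
theorem log_tTop (hd : 1 ≤ d) (q : ℝ) : 2 * d * Real.log (tTop d q) - Real.log q = 1 := by
  have h1 : (1 : ℝ) ≤ d := by exact_mod_cast hd
  have : (0 : ℝ) < 2 * d := by linarith
  rw [tTop, Real.log_exp]; field_simp; ring

/-- `2d log t_bot - log q = -1`. [folklore] -/
theorem log_tBot (hd : 1 ≤ d) (q : ℝ) : 2 * d * Real.log (tBot d q) - Real.log q = -1 := by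
  have h1 : (1 : ℝ) ≤ d := by exact_mod_cast hd
  have : (0 : ℝ) < 2 * d := by linarith
  rw [tBot, Real.log_exp]; field_simp; ring

/-- The ground weights in logarithm. [folklore] -/
theorem log_w_rcModel {t q : ℝ} :
    Real.log (groundW d t q Phase.ord) = 2 * d * Real.log t ∧ Real.log (groundW d t q Phase.dis) = Real.log q := by
  constructor
  · rw [groundW, if_pos rfl, Real.log_pow]; push_cast; ring
  · rw [groundW, if_neg (fun h => Phase.noConfusion h)]

/-- **At the upper end of the window the `ord` phase is stable.** [cite: FriedliVelenik2017, §7.4.1; Grimmett2006, §7.5] -/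
theorem ord_stable_tTop (hd : 2 ≤ d) {q : ℝ} (hq : 1 ≤ q)
    (hreg : StableRegime d q) :
    (rcModel d (t := tTop d q) (Real.exp_pos _) (q_pos_of_one_le hq)).excess (rcPeierlsRate d q - 4 ^ (d + 2)) Phase.ord = 0 := by
  refine excess_eq_zero_of_log_le' hd (Real.exp_pos _) (q_pos_of_one_le hq) hreg ?_
  obtain ⟨ho, hdis⟩ := log_w_rcModel (d := d) (t := tTop d q) (q := q)
  change Real.log (groundW d (tTop d q) q Phase.dis) + _ ≤ Real.log (groundW d (tTop d q) q Phase.ord)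
  rw [ho, hdis]
  have h1 := log_tTop (by omega : 1 ≤ d) q
  have h2 := two_mul_exp_neg_le_one d
  linarith

/-- **At the lower end of the window the `dis` phase is stable.** [cite: FriedliVelenik2017, §7.4.1; Grimmett2006, §7.5] -/
theorem dis_stable_tBot (hd : 2 ≤ d) {q : ℝ} (hq : 1 ≤ q)
    (hreg : StableRegime d q) :
    (rcModel d (t := tBot d q) (Real.exp_pos _) (q_pos_of_one_le hq)).excess (rcPeierlsRate d q - 4 ^ (d + 2)) Phase.dis = 0 := by
  refine excess_eq_zero_of_log_le' hd (Real.exp_pos _) (q_pos_of_one_le hq) hreg ?_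
  obtain ⟨ho, hdis⟩ := log_w_rcModel (d := d) (t := tBot d q) (q := q)
  change Real.log (groundW d (tBot d q) q Phase.ord) + _ ≤ Real.log (groundW d (tBot d q) q Phase.dis)
  rw [ho, hdis]
  have h1 := log_tBot (by omega : 1 ≤ d) q
  have h2 := two_mul_exp_neg_le_one d
  linarith

/-! ### The parametrisation `p ↦ t` -/

/-- The inverse parametrisation `t(p) = (p/(1-p))^{1/2}`. [cite: Grimmett2006, §1.2] -/
def tOf (p : ℝ) : ℝ := Real.sqrt (p / (1 - p))

/-- `t(p(t)) = t` for `t > 0`. [folklore] -/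
theorem tOf_pOf {t : ℝ} (ht : 0 < t) : tOf (pOf t) = t := by
  rw [tOf, pOf_div, Real.sqrt_sq ht.le]

/-- `p(t(p)) = p` for `0 ≤ p < 1`. [folklore] -/
theorem pOf_tOf {p : ℝ} (hp0 : 0 ≤ p) (hp1 : p < 1) : pOf (tOf p) = p := by
  have h1 : 0 < 1 - p := by linarith
  rw [pOf, tOf, Real.sq_sqrt (div_nonneg hp0 h1.le)]
  field_simp
  ring

/-- `pOf` is monotone on `t ≥ 0`. [folklore] -/
theorem pOf_le_pOf {a b : ℝ} (ha : 0 ≤ a) (hab : a ≤ b) : pOf a ≤ pOf b := by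
  rw [pOf, pOf, div_le_div_iff₀ (by positivity) (by positivity)]
  nlinarith [mul_le_mul hab hab ha (ha.trans hab)]

/-- `tOf` is monotone on `[0,1)`. [folklore] -/
theorem tOf_le_tOf {a b : ℝ} (ha : 0 ≤ a) (hab : a ≤ b) (hb : b < 1) : tOf a ≤ tOf b := by
  rw [tOf, tOf]
  refine Real.sqrt_le_sqrt (div_le_div₀ (ha.trans hab) hab (by linarith) (by linarith))

end RandomClusterFirstOrderPS

/-! ### The main theorem -/

open RandomClusterFirstOrderPS in
/-- **Discharge of the barrier `RandomClusterFirstOrder`** (Grimmett 2006, Thm. (7.33)(b), wired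
half; LMMRS 1991): for `d ≥ 2` and real `q > Q(d)`, `θ¹(p_c(q), q) > 0`.
[cite: Grimmett2006, Thm. (7.33)(b) and its proof, §7.5, eqs. (7.79)–(7.83)] -/
theorem RandomClusterFirstOrder_holds : RandomClusterFirstOrder := by
  refine RandomClusterFirstOrder_of_dichotomy fun d hd => ⟨Qof d, fun q hQ hq => ?_⟩
  have hd1 : 1 ≤ d := by omega
  obtain ⟨hreg, hB⟩ := conditions_of_gt hd1 hq hQ
  have hd1' : (1 : ℝ) ≤ d := by exact_mod_cast hd1
  have hd0 : (0 : ℝ) < 2 * d := by linarith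
  -- the window in `t` and in `p`
  have htb : 0 < tBot d q := Real.exp_pos _
  have htt : 0 < tTop d q := Real.exp_pos _
  have hbt : tBot d q ≤ tTop d q := Real.exp_le_exp.2 (div_le_div_of_nonneg_right (by linarith) hd0.le)
  have hwin : ∀ t, tBot d q ≤ t → t ≤ tTop d q → |2 * d * Real.log t - Real.log q| ≤ 1 := by
    intro t h1 h2
    have ht : 0 < t := htb.trans_le h1
    have hl1 := Real.log_le_log htb h1
    have hl2 := Real.log_le_log ht h2
    rw [tBot, Real.log_exp] at hl1
    rw [tTop, Real.log_exp] at hl2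
    rw [abs_le]
    constructor
    · have := mul_le_mul_of_nonneg_left hl1 hd0.le
      rw [mul_div_cancel₀ _ hd0.ne'] at this; linarith
    · have := mul_le_mul_of_nonneg_left hl2 hd0.le
      rw [mul_div_cancel₀ _ hd0.ne'] at this; linarith
  refine ⟨pOf (tBot d q), pOf (tTop d q), 1 / 2, by norm_num, (pOf_mem _ htb).1.le, pOf_le_pOf htb.le hbt, (pOf_mem _ htt).2,
    fun p hp => ?_, ?_, ?_⟩
  · -- interior points: `p = pOf (tOf p)` with `tOf p` in the window
    obtain ⟨hp1, hp2⟩ := hp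
    have hp0 : 0 ≤ p := (pOf_mem _ htb).1.le.trans hp1
    have hp1' : p < 1 := hp2.trans_lt (pOf_mem _ htt).2
    have hrep : pOf (tOf p) = p := pOf_tOf hp0 hp1'
    have ht1 : tBot d q ≤ tOf p := by rw [← tOf_pOf htb]; exact tOf_le_tOf (pOf_mem _ htb).1.le hp1 hp1'
    have ht2 : tOf p ≤ tTop d q := by rw [← tOf_pOf htt]; exact tOf_le_tOf hp0 hp2 (pOf_mem _ htt).2
    have htp : 0 < tOf p := htb.trans_le ht1
    rw [← hrep]
    exact window_dichotomy hd hq htp (hwin _ ht1 ht2) hreg hB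
  · -- top: `ord` is stable
    exact fun n => half_le_thetaWiredBox hd hq htt (hwin _ hbt le_rfl) hreg (ord_stable_tTop hd hq hreg) hB n
  · -- bottom: `dis` is stable
    exact mem_freeDecaySet_of_dis hd hq htb (hwin _ le_rfl hbt) hreg (dis_stable_tBot hd hq hreg) hB

end Literature.Barriers.CriticalPhenomena

end
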